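import Literature.Topology.FourManifolds.MMSWTowerAdjunction
import Literature.Topology.FourManifolds.ProjectiveTowersProofs
import HarnessLib

/-!
# MMSW Lemma 8.19 for discs (`MMSW.sMinus_nonpos_of_isModelSliceDisc`): reduction to the tower fact

Sibling proof file of `Literature/Topology/FourManifolds/MMSWRasmussenFacts.lean` for its named
fact `Literature.Topology.FourManifolds.MMSW.sMinus_nonpos_of_isModelSliceDisc` — C. Manolescu,
M. Marengon, S. Sarkar, M. Willis, *A generalization of Rasmussen's invariant, with applications
to surfaces in some four-manifolds*, Duke Math. J. 172 (2023) 231–311 (arXiv:1910.08195),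
**Lemma 8.19** in the case of a knot bounding a disc: a null-homologous knot `K ⊂ M_r = ∂D_r`
with `s₋(K) = s` that bounds a smooth proper disc in `ℝ⁴ ∖ D_r° ⊂ S⁴ ∖ D_r° ≅ ♮ʳ(B² × S²)` has
`s ≤ 0`.

## The printed proof (p. 25 of arXiv v3) and why the fact is not discharged here

Lemma 8.19 (`s₋(L) ≤ 1 − χ(Σ)` for a properly embedded `Σ ⊂ ♮ʳ(B² × S²)` without closed
components, `∂Σ = L` null-homologous) is proved in five steps: (a) model `♮ʳ(B² × S²)` with the CW
complex `A` of the `S²`-cores joined by arcs, whose complement `♮ʳ(B² × S²) ∖ ν(A)` is `I × M_r`;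
(b) transversality — `Σ` misses the arcs and meets the cores transversally, with as many positive
as negative points by Remark 8.15 (`[Σ] · [coreᵢ] = 0` from the exact sequence of `(X, ∂X)` and
`[L] = 0`); (c) `Σ° = Σ ∖ ν(A)` is a cobordism in `I × M_r` from `L` to `⊔ᵢ F_{pᵢ,pᵢ}` all of
whose components meet `L`; (d) the cobordism inequality Cor. 8.11 (from Thm. 8.10, the strong
adjunction inequality for the deformed Khovanov–Lee homology of links in `#ʳ(S¹ × S²)`, §§2–3,
with the finite approximation theorem Thm. 1.4) and `s(F_p) = 1 − 2p` (Thm. 1.6, via Hochschild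
homology, §§4–5) give `s₋(L) ≤ 1 − Σ 2pᵢ − χ(Σ°)`; (e) `χ(Σ°) = 2σ − 2g − ℓ − Σ 2pᵢ`.  Step (d)
lives on the `s`-invariant of LINKS in `#ʳ(S¹ × S²)` and on the maps induced on Lee homology by
link cobordisms; the tree's `GaussDiagram` / `KhComplex` / `LeeRasmussen` layer is knots-in-`S³`
only and has no cobordism maps — the same gap that keeps Rasmussen's
`Literature.Topology.FourManifolds.eq_zero_of_isSmoothlySlice` (Rasmussen 2010, Thm. 1; the case
`r = 0` of the present fact, up to the passage from the model `∂D_0` to `S³`) and the tower form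
`Literature.Topology.FourManifolds.MMSW.sMinus_nonpos_of_isTowerSliceInComplement`
(`MMSWTowerAdjunction.lean`) named facts.  So the fact is NOT discharged in this file; no
definition and no named fact is introduced.

## What is proved here

* `MMSW.IsModelSliceDisc.isSliceDiscInComplement_comp` — **pushing a model slice disc forward
  along a chart**: if `f` is a model slice disc for `K` (interior off `D_r`, boundary `K`) and
  `e : ℝ⁴ → X` is a smooth embedding with injective differentials, then `(e, e ∘ f)` is a slice
  datum for `K` in the complement of `e(D_r)` inside `X` (`MMSW.IsSliceDiscInComplement`, the disc
  clause of the route `SmoothPoincare4/DottedCircleRasmussen`); the case `e = id` is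
  `MMSW.isSliceDiscInComplement_id_iff`.
* `MMSW.IsModelSliceDisc.isSliceDiscInComplement_chartAt_symm` — in particular along the round
  ball `(chartAt a)⁻¹ = σ₋ₐ⁻¹ : ℝ⁴ → S⁴` of the stereographic chart of `S⁴` at any point `a`
  (`isSmoothEmbedding_stereographic'_symm`, `injective_mfderiv_stereographic'_symm`).
* `MMSW.sMinus_nonpos_of_isModelSliceDisc_of_isTowerSliceInComplement` — **the fact is the
  height-`0` layer of the tower fact**: GIVEN `MMSW.sMinus_nonpos_of_isTowerSliceInComplement`
  (for one orientation `o` of `ℂℙ²`, every model knot tower-slice in the complement over `o` has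
  `s₋ ≤ 0`), the present fact holds — push the disc into `S⁴` by `σ⁻¹`, orient `S⁴` so that `σ⁻¹`
  is orientation preserving (`exists_smoothOrientation_sphere`,
  `isOrientationPreserving_or_isOrientationReversing_disc`), take `U = S⁴` with `H₂(S⁴; ℤ) = 0`
  (`Knot.isZero_singularHomologyZ_two_sphere_four_top`), and apply the height-`0` corollary
  `MMSW.sMinus_nonpos_of_isSliceDiscInComplement_sphere` (height `0` is orientation-free).
  Hence `theorem sMinus_nonpos_of_isModelSliceDisc_holds` is one line once the tower fact is
  discharged; conversely nothing short of the printed Khovanov–Lee theory discharges either.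
* `MMSW.sMinus_nonpos_sPlus_nonneg_of_isModelSliceDisc_of_isTowerSliceInComplement`,
  `MMSWRasmussen.sMinus_nonpos_sPlus_nonneg_of_isTowerSliceInComplement` — the slice window
  `s₋(K) ≤ 0 ≤ s₊(K)` (Lemma 8.19 for the disc and its `ρ`-reflection) and its bundled form,
  GIVEN the tower fact alone.

## References

* C. Manolescu, M. Marengon, S. Sarkar, M. Willis, Duke Math. J. 172 (2023) 231–311,
  arXiv:1910.08195: Lemma 8.19 and its proof (p. 25), Thm. 1.6, Thm. 8.10, Cor. 8.11, Def. 8.14,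
  Remark 8.15 [ManolescuMarengonSarkarWillis2023].
* R. Kirby, *The Topology of 4-Manifolds*, LNM 1374 (1989), Ch. I §2
  (`S⁴ ∖ D_r° ≅ ♮ʳ(B² × S²)`) [Kirby1989].
* M. W. Hirsch, *Differential Topology*, GTM 33 (1976), §4.4 (orientation of discs)
  [HirschDT1976].
* A. Hatcher, *Algebraic Topology* (2002), Cor. 2.14 (`H₂(S⁴) = 0`) [HatcherAT2002].
-/

noncomputable section

open scoped Manifold ContDiff Topology
open Function Set

namespace Literature.Topology.FourManifolds

namespace MMSW

variable {r : ℕ} {K : Metric.sphere (0 : EuclideanSpace ℝ (Fin 2)) 1 → EuclideanSpace ℝ (Fin 4)}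
  {f : EuclideanSpace ℝ (Fin 2) → EuclideanSpace ℝ (Fin 4)}

/-! ### Pushing a model slice disc forward along a chart -/

/-- **A model slice disc pushed forward along a smooth chart is a slice datum in the
complement.**  If `f|_{𝔻²}` is a smooth embedded disc in `ℝ⁴` with interior off the dotted
handlebody `D_r` and boundary the model knot `K` (`IsModelSliceDisc r K f`), and `e : ℝ⁴ → X` is
a smooth embedding whose differentials are injective, then `(e, e ∘ f)` is a slice datum for `K`
in the complement of `e(D_r)` inside `X` (`IsSliceDiscInComplement r K X e (e ∘ f)`): smooth
maps compose, `e` is injective (so the interior of `e ∘ f` misses `e(D_r)` and `e ∘ f` is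
injective on `𝔻²`), and by the chain rule the differential of `e ∘ f` is the composition of two
injective linear maps.  The case `e = id` is `isSliceDiscInComplement_id_iff`. [folklore] -/
theorem IsModelSliceDisc.isSliceDiscInComplement_comp (hf : IsModelSliceDisc r K f) {X : Type*}
    [TopologicalSpace X] [ChartedSpace (EuclideanSpace ℝ (Fin 4)) X]
    {e : EuclideanSpace ℝ (Fin 4) → X} (he : Manifold.IsSmoothEmbedding (𝓡 4) (𝓡 4) ∞ e)
    (hde : ∀ y, Injective (mfderiv (𝓡 4) (𝓡 4) e y)) :
    IsSliceDiscInComplement r K X e (e ∘ f) := by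
  obtain ⟨hfs, hinj, hd, hout, hb⟩ := hf
  have heinj : Injective e := he.isEmbedding.injective
  refine ⟨he, he.contMDiff.comp hfs, heinj.comp_injOn hinj, fun x hx ↦ ?_, fun x hx hmem ↦ ?_,
    fun t ↦ ?_⟩
  · have h1 : MDifferentiableAt (𝓡 4) (𝓡 4) e (f x) := he.contMDiff.mdifferentiableAt (by simp)
    have h2 : MDifferentiableAt (𝓡 2) (𝓡 4) f x := hfs.mdifferentiableAt (by simp)
    rw [mfderiv_comp x h1 h2]
    exact (hde (f x)).comp (hd x hx)
  · obtain ⟨y, hy, hyx⟩ := hmem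
    have hyx' : y = f x := heinj hyx
    subst hyx'
    exact hout x hx hy
  · show e (f _) = e (K t)
    rw [hb t]

/-- **The model slice disc pushed into `S⁴`.**  For any point `a ∈ S⁴`, the round ball
`(chartAt a)⁻¹ = σ₋ₐ⁻¹ : ℝ⁴ → S⁴` (inverse of the stereographic chart of `S⁴` at `a`) is a smooth
embedding with injective differentials (`isSmoothEmbedding_stereographic'_symm`,
`injective_mfderiv_stereographic'_symm`), so a model slice disc `f` for `K` becomes the slice
datum `((chartAt a)⁻¹, (chartAt a)⁻¹ ∘ f)` for `K` in the complement of the image of `D_r`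
inside `S⁴`. [folklore] -/
theorem IsModelSliceDisc.isSliceDiscInComplement_chartAt_symm (hf : IsModelSliceDisc r K f)
    (a : Metric.sphere (0 : EuclideanSpace ℝ (Fin 5)) 1) :
    IsSliceDiscInComplement r K (Metric.sphere (0 : EuclideanSpace ℝ (Fin 5)) 1)
      (chartAt (EuclideanSpace ℝ (Fin 4)) a).symm
      ((chartAt (EuclideanSpace ℝ (Fin 4)) a).symm ∘ f) := by
  letI := Knot.fact_finrank_euclideanSpace_four_add_one
  have hc : chartAt (EuclideanSpace ℝ (Fin 4)) a = stereographic' 4 (-a) := rfl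
  rw [hc]
  exact hf.isSliceDiscInComplement_comp (isSmoothEmbedding_stereographic'_symm (-a))
    (injective_mfderiv_stereographic'_symm (-a))

/-! ### The fact is the height-`0` layer of the tower fact -/

/-- **MMSW Lemma 8.19 for discs follows from the tower form of the adjunction inequality
(`MMSW.sMinus_nonpos_of_isTowerSliceInComplement`), at height `0`.**  GIVEN that named fact —
for one orientation `o` of `ℂℙ²`, every model knot `K ⊂ ∂D_k` with `s₋(K) = s` that is
tower-slice in the complement over `o` has `s ≤ 0` — every model knot with `s₋(K) = s` bounding
a model slice disc `f` (`IsModelSliceDisc`: a smooth proper disc in `ℝ⁴ ∖ D_r°`) has `s ≤ 0`: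
push the disc into `S⁴` by the round ball `e = (chartAt a)⁻¹`
(`IsModelSliceDisc.isSliceDiscInComplement_chartAt_symm`), choose the orientation of `S⁴` for
which `e` is orientation preserving (`exists_smoothOrientation_sphere`; a disc preserves or
reverses a given orientation, `isOrientationPreserving_or_isOrientationReversing_disc`, and in
the second case pass to the opposite orientation), take `U = S⁴`, `H₂(S⁴; ℤ) = 0`
(`Knot.isZero_singularHomologyZ_two_sphere_four_top`), and apply the height-`0` corollary
`sMinus_nonpos_of_isSliceDiscInComplement_sphere` of the tower fact (a tower of height `0` is
any manifold diffeomorphic to `S⁴`, whichever `o`).  This is the `t = 0` case of the module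
docstring of `MMSWTowerAdjunction.lean` ("its `t = 0` case Lemma 8.19"), made formal;
`sMinus_nonpos_of_isModelSliceDisc_holds` is this theorem applied to a discharge of the tower
fact. [cite: ManolescuMarengonSarkarWillis2023, Lemma 8.19 and Thm. 8.10] -/
theorem sMinus_nonpos_of_isModelSliceDisc_of_isTowerSliceInComplement
    (h : sMinus_nonpos_of_isTowerSliceInComplement) : sMinus_nonpos_of_isModelSliceDisc := by
  intro r K s f hs hf
  -- the round ball of the stereographic chart at the point `a = (1, 0, 0, 0, 0)`
  let a : Metric.sphere (0 : EuclideanSpace ℝ (Fin 5)) 1 := ⟨EuclideanSpace.single 0 1, by simp⟩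
  have hslice := hf.isSliceDiscInComplement_chartAt_symm a
  have hemb : Manifold.IsSmoothEmbedding (𝓡 4) (𝓡 4) ∞
      (chartAt (EuclideanSpace ℝ (Fin 4)) a).symm :=
    hslice.1
  -- orient `S⁴` so that the ball is orientation preserving
  obtain ⟨oS, -⟩ := exists_smoothOrientation_sphere 4
  obtain ⟨oP, hoP⟩ :
      ∃ oP : SmoothOrientation (𝓡 4) (Metric.sphere (0 : EuclideanSpace ℝ (Fin 5)) 1),
        IsOrientationPreserving (SmoothOrientation.euclidean 4) oP
          (chartAt (EuclideanSpace ℝ (Fin 4)) a).symm := by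
    rcases isOrientationPreserving_or_isOrientationReversing_disc hemb
        (isOpenMap_disc hemb).isOpen_range (euclideanOrientation 4) oS with h' | h'
    · exact ⟨oS, h'⟩
    · exact ⟨-oS, h'⟩
  -- height `0`: `S⁴` with `U = S⁴`, `H₂(S⁴; ℤ) = 0`
  exact sMinus_nonpos_of_isSliceDiscInComplement_sphere h ⟨Diffeomorph.refl _ _ _⟩ oP hslice hoP
    ⟨⊤, fun _ ↦ trivial, fun _ ↦ trivial, Knot.isZero_singularHomologyZ_two_sphere_four_top⟩ hs

/-- **The slice window `s₋(K) ≤ 0 ≤ s₊(K)` from the tower fact.**  GIVEN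
`MMSW.sMinus_nonpos_of_isTowerSliceInComplement`, a null-homologous model knot with
`s₋(K) = s₁`, `s₊(K) = s₂` bounding a model slice disc in `ℝ⁴ ∖ D_r°` satisfies `s₁ ≤ 0 ≤ s₂` —
Lemma 8.19 for the disc and for its reflection by the model mirror `ρ`
(`sMinus_nonpos_sPlus_nonneg_of_isModelSliceDisc`, fed with the reduction
`sMinus_nonpos_of_isModelSliceDisc_of_isTowerSliceInComplement`).
[cite: ManolescuMarengonSarkarWillis2023, Lemma 8.19 and Prop. 8.8 (1)] -/
theorem sMinus_nonpos_sPlus_nonneg_of_isModelSliceDisc_of_isTowerSliceInComplement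
    (h : sMinus_nonpos_of_isTowerSliceInComplement) {s₁ s₂ : ℤ} (h₁ : HasSMinus r K s₁)
    (h₂ : HasSPlus r K s₂) (hf : IsModelSliceDisc r K f) : s₁ ≤ 0 ∧ 0 ≤ s₂ :=
  sMinus_nonpos_sPlus_nonneg_of_isModelSliceDisc
    (sMinus_nonpos_of_isModelSliceDisc_of_isTowerSliceInComplement h) h₁ h₂ hf

end MMSW

/-- **The GFGMW window for the bundled invariant, from the tower fact.**  GIVEN
`MMSW.sMinus_nonpos_of_isTowerSliceInComplement`, a knot with MMSW invariants `w` that bounds a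
model slice disc in `ℝ⁴ ∖ D_r°` has `w.sMinus ≤ 0 ∧ 0 ≤ w.sPlus`
(`MMSWRasmussen.sMinus_nonpos_sPlus_nonneg` fed with the reduction of Lemma 8.19 for discs to
the tower fact) — the shape in which the route `SmoothPoincare4/DottedCircleRasmussen`
quantifies (`∀ w : MMSWRasmussen k K₀, …`). [cite: ManolescuMarengonSarkarWillis2023, Lemma 8.19] -/
theorem MMSWRasmussen.sMinus_nonpos_sPlus_nonneg_of_isTowerSliceInComplement
    (h : MMSW.sMinus_nonpos_of_isTowerSliceInComplement) {r : ℕ}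
    {K : Metric.sphere (0 : EuclideanSpace ℝ (Fin 2)) 1 → EuclideanSpace ℝ (Fin 4)}
    (w : MMSWRasmussen r K) {f : EuclideanSpace ℝ (Fin 2) → EuclideanSpace ℝ (Fin 4)}
    (hf : MMSW.IsModelSliceDisc r K f) : w.sMinus ≤ 0 ∧ 0 ≤ w.sPlus :=
  w.sMinus_nonpos_sPlus_nonneg (MMSW.sMinus_nonpos_of_isModelSliceDisc_of_isTowerSliceInComplement h)
    hf

end Literature.Topology.FourManifolds

end
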